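import Mathlib

/-!
# Liouville's theorem for entire functions of polynomial growth

An entire function `V : ℂ → ℂ` with `‖V q‖ ≤ C ‖q‖ ^ t` for `‖q‖ ≥ 1` and `t < n` is a polynomial of degree `< n`
(iterate `dslope` at `0` and Liouville's theorem `Differentiable.apply_eq_apply_of_bounded`).
-/

namespace Literature.Analysis.Complex

open _root_.Complex Set Metric Filter
open scoped Topology

/-- An entire function with `‖V q‖ ≤ C ‖q‖ ^ t` for `‖q‖ ≥ 1`, `t < 0`, vanishes identically (Liouville). [folklore] -/
theorem eq_zero_of_differentiable_of_growth_neg {V : ℂ → ℂ} {t C : ℝ} (ht : t < 0)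
    (hV : Differentiable ℂ V) (hb : ∀ q : ℂ, 1 ≤ ‖q‖ → ‖V q‖ ≤ C * ‖q‖ ^ t) :
    ∀ q, V q = 0 := by
  obtain ⟨M, hM⟩ : ∃ M, ∀ q ∈ closedBall (0:ℂ) 1, ‖V q‖ ≤ M :=
    (isCompact_closedBall 0 1).exists_bound_of_continuousOn hV.continuous.continuousOn
  have hC : ∀ q : ℂ, 1 ≤ ‖q‖ → ‖V q‖ ≤ max C 0 := by
    intro q hq
    calc ‖V q‖ ≤ C * ‖q‖ ^ t := hb q hq
      _ ≤ max C 0 * ‖q‖ ^ t :=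
          mul_le_mul_of_nonneg_right (le_max_left _ _) (Real.rpow_nonneg (norm_nonneg _) _)
      _ ≤ max C 0 * 1 :=
          mul_le_mul_of_nonneg_left (Real.rpow_le_one_of_one_le_of_nonpos hq ht.le) (le_max_right _ _)
      _ = max C 0 := mul_one _
  have hbound : ∀ q, ‖V q‖ ≤ max M (max C 0) := by
    intro q
    rcases le_or_gt ‖q‖ 1 with h | h
    · exact (hM q (by simpa using h)).trans (le_max_left _ _)
    · exact (hC q h.le).trans (le_max_right _ _)
  have hrange : Bornology.IsBounded (range V) :=
    isBounded_iff_forall_norm_le.mpr ⟨_, by rintro _ ⟨q, rfl⟩; exact hbound q⟩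
  have hconst : ∀ q, V q = V 0 := fun q => hV.apply_eq_apply_of_bounded hrange q 0
  -- `V 0 = 0`: `‖V 0‖ = ‖V R‖ ≤ C R ^ t → 0` as `R → ∞`.
  have hlim : Tendsto (fun R : ℝ => C * R ^ t) atTop (𝓝 (C * 0)) := by
    have := (tendsto_rpow_neg_atTop (neg_pos.mpr ht)).const_mul C
    simpa only [neg_neg] using this
  have hev : ∀ᶠ R : ℝ in atTop, ‖V 0‖ ≤ C * R ^ t := by
    filter_upwards [eventually_ge_atTop (1:ℝ)] with R hR
    have h1 : 1 ≤ ‖(R : ℂ)‖ := by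
      rw [norm_real, Real.norm_eq_abs]; exact hR.trans (le_abs_self R)
    have := hb (R : ℂ) h1
    rw [hconst (R : ℂ)] at this
    rw [norm_real, Real.norm_eq_abs, abs_of_nonneg (by linarith)] at this
    exact this
  have h0 : ‖V 0‖ ≤ C * 0 := ge_of_tendsto hlim hev
  have hV0 : V 0 = 0 := by simpa using h0
  intro q; rw [hconst q, hV0]

/-- **Liouville, polynomial growth.** An entire function with `‖V q‖ ≤ C ‖q‖ ^ t` for `‖q‖ ≥ 1` and `t < n`
is a polynomial of degree `< n`: `V q = ∑_{k<n} c_k q^k`. [folklore] -/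
theorem exists_eq_sum_of_differentiable_of_growth (n : ℕ) :
    ∀ (V : ℂ → ℂ) (t C : ℝ), t < n → Differentiable ℂ V →
      (∀ q : ℂ, 1 ≤ ‖q‖ → ‖V q‖ ≤ C * ‖q‖ ^ t) →
      ∃ c : ℕ → ℂ, ∀ q, V q = ∑ k ∈ Finset.range n, c k * q ^ k := by
  induction n with
  | zero =>
    intro V t C ht hV hb
    refine ⟨fun _ => 0, fun q => ?_⟩
    simp only [Finset.range_zero, Finset.sum_empty]
    exact eq_zero_of_differentiable_of_growth_neg (by exact_mod_cast ht) hV hb q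
  | succ n ih =>
    intro V t C ht hV hb
    set W : ℂ → ℂ := dslope V 0 with hW
    have hWd : Differentiable ℂ W :=
      differentiableOn_univ.mp ((differentiableOn_dslope Filter.univ_mem).mpr hV.differentiableOn)
    set t' : ℝ := max t 0 with ht'
    have ht'n : t' - 1 < n := by
      have h1 : t' < n + 1 := max_lt (by exact_mod_cast ht) (by positivity)
      linarith
    set K : ℝ := max C 0 + ‖V 0‖ with hK
    have hWb : ∀ q : ℂ, 1 ≤ ‖q‖ → ‖W q‖ ≤ K * ‖q‖ ^ (t' - 1) := by
      intro q hq
      have hq0 : q ≠ 0 := by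
        intro h; rw [h, norm_zero] at hq; exact absurd hq (by norm_num)
      have hqpos : 0 < ‖q‖ := norm_pos_iff.mpr hq0
      have hWq : W q = q⁻¹ • (V q - V 0) := by
        rw [hW, dslope_of_ne V hq0, slope_def_module, sub_zero]
      have h1 : ‖V q‖ ≤ max C 0 * ‖q‖ ^ t' := by
        calc ‖V q‖ ≤ C * ‖q‖ ^ t := hb q hq
          _ ≤ max C 0 * ‖q‖ ^ t :=
              mul_le_mul_of_nonneg_right (le_max_left _ _) (Real.rpow_nonneg (norm_nonneg _) _)
          _ ≤ max C 0 * ‖q‖ ^ t' :=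
              mul_le_mul_of_nonneg_left (Real.rpow_le_rpow_of_exponent_le hq (le_max_left _ _))
                (le_max_right _ _)
      have h2 : ‖V 0‖ ≤ ‖V 0‖ * ‖q‖ ^ t' := by
        have : 1 ≤ ‖q‖ ^ t' := Real.one_le_rpow hq (le_max_right _ _)
        nlinarith [norm_nonneg (V 0)]
      rw [hWq, norm_smul, norm_inv, Real.rpow_sub_one hqpos.ne', hK]
      rw [mul_div_assoc']
      rw [le_div_iff₀ hqpos]
      calc ‖q‖⁻¹ * ‖V q - V 0‖ * ‖q‖ = ‖V q - V 0‖ := by field_simp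
        _ ≤ ‖V q‖ + ‖V 0‖ := norm_sub_le _ _
        _ ≤ max C 0 * ‖q‖ ^ t' + ‖V 0‖ * ‖q‖ ^ t' := add_le_add h1 h2
        _ = (max C 0 + ‖V 0‖) * ‖q‖ ^ t' := by ring
    obtain ⟨c, hc⟩ := ih W (t' - 1) K ht'n hWd hWb
    refine ⟨fun k => Nat.rec (V 0) (fun j _ => c j) k, fun q => ?_⟩
    have hVq : V q = V 0 + q * W q := by
      have := sub_smul_dslope V 0 q
      rw [sub_zero, smul_eq_mul] at this
      rw [hW] at *
      linear_combination -this
    rw [hVq, hc q, Finset.sum_range_succ', Finset.mul_sum, add_comm]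
    simp only [pow_zero, mul_one, pow_succ]
    congr 1
    refine Finset.sum_congr rfl fun k _ => ?_
    ring
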